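import Summits.QuantumFields.YangMills.Theorems.UnitScaleTiltProp7TrueAvgBudgetCentral
import Summits.QuantumFields.YangMills.Theorems.UnitScaleTiltProp7DivSliceOfMemberDivSq
import Summits.QuantumFields.YangMills.Theorems.UnitScaleTiltProp7SectET3CombLettersT3
import HarnessLib

/-!
# Route `UnitScaleTilt`, crux K1 child «MinimiserStabilityRegPr» (stmt-QuantumFields-19200), stub `stub_existenceMinimalOrbit` (EX), lane II (QH1)♮ —
# **THE CENTRAL (QH1) ROW `hcen` OF ✓`Prop7QH1OfSectors.hQH1_of_sectors` DOES NOT SEE THE BACKGROUND: IT FOLLOWS FROM THE SAME ROW AT `W = 1`**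
# (the (QH1) twin of ✓`Prop7TrueAvgBudgetCentral.trueAvgBudget_smul_one_of_flat`; offer «hcen_of_flat», bus 12:52Z)

Cell `ym3-torus`, width seat `ym3-torus-px10` (gen 5).  `--supports stmt-QuantumFields-19200 --as helper`; THEOREMS ONLY (0 `def`, 0 `sorry`); count-neutral; nothing here claims the
stub, the crux, d = 4 or the mass gap — YM₃ on T³ is a ladder rung (R3), not the Clay problem.

THE MATHEMATICS.  On a central one-form `f = toL2 (τ•1)` the comb averaging of record does not see the background: `Qkc W (toL2 (τ•1)) = η • toL2B (QTw W (τ•1)) = η • toL2B (QTw 1 (τ•1))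
= Qkc 1 (toL2 (τ•1))` (✓`Qkc_toL2` ∘ ✓`Prop7QTwCentralSectorRegPr.QTw_smul_one_eq_QTw_one_of_regPr`, window `10⁷L³e ≤ 1`), `‖toL2 (τ•1)‖` has no background, and a member functional
`H` that is background-free on central fields — here the door's `H := c₀L·ℓ²·CURL_HS + ‖D*_W ·‖²` of ✓`Prop7QH1SectorRowsOfH`, by ✓(8) §1 `curl_smul_one_eq`∕`divB_smul_one_eq` through
✓`norm_sq_DstarL2_toL2_eq` — completes the reduction: the `hcen` binder of ✓p718170 (at `H :=` the door) at every `W ∈ RegPr F n K e`, `e ≤ min eQ (10⁷L³)⁻¹`,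
follows from the FLAT central (QH1)♮ row (px22 g6's ✓-to-be `Prop7QH1CentralRowFlat.hcen_one`, hypothesis `hflat` in its exact text), with the same `B B′ B″` and `eQ ↦ min eQ (10⁷L³)⁻¹`.

WHAT IS PROVED (sorry-free, no definition):
* §1 `Qkc_toL2_smul_one_eq_one_of_regPr` — `Qkc W (toL2 (τ•1)) = Qkc 1 (toL2 (τ•1))` on `RegPr`, `10⁷L³e ≤ 1`.
* §2 ★`doorH_smul_one_eq_one` — the door's `H` (`c₀L·ℓ²·CURL_HS(W, toL2⁻¹f) + ‖D*_W f‖²`, ✓`Prop7QH1SectorRowsOfH`'s lambda, β-reduced at `f := toL2 (τ•1)`) takes the same value at `W` and at `1`.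
* §3 ★★★`hcen_doorH_of_flat (hflat : ⟨px22 g6's `hcen_one` text VERBATIM⟩) : ⟨✓p718170's `hcen` with `H :=` the door lambda, VERBATIM⟩`, constants `(B, B′, B″, min eQ (10⁷L³)⁻¹)`.
HONEST SCOPE.  By-name knit; the flat central (QH1)♮ row itself is NOT proved here (px22 g6's chain: ✓`QTw_one_eq_tube_sub_coarseGrad` ⊕ tube Jensen ⊕ ✓`slegs_flat_T3` ⊕ ✓`rlegs_flat`);
nothing of (QH1)∕(REC)∕`hN06`∕the crux is advanced by this file alone.

References: T. Bałaban, CMP **99** (1985) 389–434 [Balaban1985BackgroundPropagators] ((3.4) p.391, (3.8) p.392, (3.11) p.392, (3.14)–(3.15) p.393, (3.19)–(3.26) pp.393–395); CMP **102**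
(1985) 277–309 [Balaban1985Variational] ((44)–(45) p.285).
-/

set_option autoImplicit false

noncomputable section

open scoped BigOperators Matrix.Norms.L2Operator Matrix InnerProductSpace ComplexConjugate

namespace Summit.QuantumFields.YangMills.Theorems.Prop7QH1CentralOfFlat

open Literature.MathematicalPhysics.QuantumFieldTheory.Balaban1983to89
open Literature.MathematicalPhysics.QuantumFieldTheory.Balaban1983to89.T3ContinuumYM3Torus
open Literature.MathematicalPhysics.QuantumFieldTheory.Balaban1983to89.T3PrintedRegularMinimiser (RegPr regPr_one)
open B9Eq39Adjoint (curl divB)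
open B10Eq27TorusAxialLog (unitsField toUField)
open B9TorusCalculus (torusT)
open B11Eq103H1Complex (BondL2K)
open Summit.QuantumFields.YangMills.Theorems.Prop7SectET3Transport (periodsT3)
open Summit.QuantumFields.YangMills.Theorems.Prop7SectET3HilbertLetters (W₂ toL2 DstarL2)
open Summit.QuantumFields.YangMills.Theorems.Prop7SectET3CombLetters (Qkc Qkc_toL2)
open Summit.QuantumFields.YangMills.Theorems.Prop7QTwCentralSectorRegPr (QTw_smul_one_eq_QTw_one_of_regPr)
open Summit.QuantumFields.YangMills.Theorems.Prop7TrueAvgBudgetCentral (curl_smul_one_eq divB_smul_one_eq)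
open Summit.QuantumFields.YangMills.Theorems.Prop7DivSliceOfMemberDivSq (norm_sq_DstarL2_toL2_eq)

variable (c₀ cB : ℕ → ℝ) [hc₀ : ∀ L : ℕ, Fact (0 < c₀ L)] [hcB : ∀ L : ℕ, Fact (0 < cB L)]

/-! ## §1 The comb averaging of record on a central one-form does not see the background -/

omit hc₀ hcB in
/-- `Qkc W (toL2 (τ•1)) = Qkc 1 (toL2 (τ•1))` at `W ∈ 𝔘_k(e)`, `10⁷L³e ≤ 1` (✓`Qkc_toL2` ∘ ✓`QTw_smul_one_eq_QTw_one_of_regPr`). [cite: Balaban1985BackgroundPropagators, (3.14) p.393; Balaban1985Variational, (44) p.285] -/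
theorem Qkc_toL2_smul_one_eq_one_of_regPr (F : T3Family) {n K : ℕ} (hnK : n ≤ K) {e : ℝ} (he : 0 < e) (hε : 10 ^ 7 * (F.L : ℝ) ^ 3 * e ≤ 1)
    (W : GaugeField (F.P K) 0 (Matrix.specialUnitaryGroup (Fin 2) ℂ)) (hreg : RegPr F n K e W) (τ : PBond (F.P K) 0 → ℂ) :
    Qkc F n K hnK (c₀ F.L) (cB F.L) W (toL2 F K (c₀ F.L) (fun b => τ b • (1 : Matrix (Fin 2) (Fin 2) ℂ)))
      = Qkc F n K hnK (c₀ F.L) (cB F.L) (1 : GaugeField (F.P K) 0 (Matrix.specialUnitaryGroup (Fin 2) ℂ))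
          (toL2 F K (c₀ F.L) (fun b => τ b • (1 : Matrix (Fin 2) (Fin 2) ℂ))) := by
  rw [Qkc_toL2, Qkc_toL2, QTw_smul_one_eq_QTw_one_of_regPr F hnK he hε W hreg τ]

/-! ## §2 The door's `H` is background-free on central one-forms -/

/-- ★ **THE DOOR'S `H` IS BACKGROUND-FREE ON CENTRAL ONE-FORMS — `H := c₀L·ℓ²·CURL_HS(W, toL2⁻¹f) + ‖D*_W f‖²`** (✓`Prop7QH1SectorRowsOfH`'s lambda, β-reduced at `f := toL2 (τ•1)`): the covariant curl and divergence of a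
central one-form are the flat ones (✓(8) `curl_smul_one_eq`∕`divB_smul_one_eq`, through ✓`norm_sq_DstarL2_toL2_eq`). [cite: Balaban1985BackgroundPropagators, (3.4) p.391, (3.8) p.392, (3.11) p.392] -/
theorem doorH_smul_one_eq_one (F : T3Family) (n K : ℕ) (W : GaugeField (F.P K) 0 (Matrix.specialUnitaryGroup (Fin 2) ℂ)) (τ : PBond (F.P K) 0 → ℂ) :
    c₀ F.L * ((F.L : ℝ) ^ (K - n)) ^ 2 * (∑ x : Site (F.P K) 0, ∑ μ : Fin (F.P K).d, ∑ ν : Fin (F.P K).d,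
        (if μ < ν then ∑ j : Fin 2, ∑ k : Fin 2,
          ‖(curl (torusT (F.P K) 0) (fun κ z => unitsField (toUField W) ⟨z, κ⟩)
              (fun κ z => (toL2 F K (c₀ F.L)).symm (toL2 F K (c₀ F.L) (fun b => τ b • (1 : Matrix (Fin 2) (Fin 2) ℂ))) ⟨z, κ⟩) μ ν x) j k‖ ^ 2 else 0))
      + ‖DstarL2 F n K (c₀ F.L) W (toL2 F K (c₀ F.L) (fun b => τ b • (1 : Matrix (Fin 2) (Fin 2) ℂ)))‖ ^ 2
    = c₀ F.L * ((F.L : ℝ) ^ (K - n)) ^ 2 * (∑ x : Site (F.P K) 0, ∑ μ : Fin (F.P K).d, ∑ ν : Fin (F.P K).d,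
        (if μ < ν then ∑ j : Fin 2, ∑ k : Fin 2,
          ‖(curl (torusT (F.P K) 0) (fun κ z => unitsField (toUField (1 : GaugeField (F.P K) 0 (Matrix.specialUnitaryGroup (Fin 2) ℂ))) ⟨z, κ⟩)
              (fun κ z => (toL2 F K (c₀ F.L)).symm (toL2 F K (c₀ F.L) (fun b => τ b • (1 : Matrix (Fin 2) (Fin 2) ℂ))) ⟨z, κ⟩) μ ν x) j k‖ ^ 2 else 0))
      + ‖DstarL2 F n K (c₀ F.L) (1 : GaugeField (F.P K) 0 (Matrix.specialUnitaryGroup (Fin 2) ℂ))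
          (toL2 F K (c₀ F.L) (fun b => τ b • (1 : Matrix (Fin 2) (Fin 2) ℂ)))‖ ^ 2 := by
  have hC : ∀ (μ ν : Fin (F.P K).d) (x : Site (F.P K) 0),
      curl (torusT (F.P K) 0) (fun κ z => unitsField (toUField W) ⟨z, κ⟩) (fun κ z => τ ⟨z, κ⟩ • (1 : Matrix (Fin 2) (Fin 2) ℂ)) μ ν x
        = curl (torusT (F.P K) 0) (fun κ z => unitsField (toUField (1 : GaugeField (F.P K) 0 (Matrix.specialUnitaryGroup (Fin 2) ℂ))) ⟨z, κ⟩)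
            (fun κ z => τ ⟨z, κ⟩ • (1 : Matrix (Fin 2) (Fin 2) ℂ)) μ ν x := fun μ ν x =>
    curl_smul_one_eq (torusT (F.P K) 0) _ _ (fun κ z => τ ⟨z, κ⟩) μ ν x
  have hD : ∀ x : Site (F.P K) 0,
      divB (torusT (F.P K) 0) (fun κ z => unitsField (toUField W) ⟨z, κ⟩) (fun κ z => τ ⟨z, κ⟩ • (1 : Matrix (Fin 2) (Fin 2) ℂ)) x
        = divB (torusT (F.P K) 0) (fun κ z => unitsField (toUField (1 : GaugeField (F.P K) 0 (Matrix.specialUnitaryGroup (Fin 2) ℂ))) ⟨z, κ⟩)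
            (fun κ z => τ ⟨z, κ⟩ • (1 : Matrix (Fin 2) (Fin 2) ℂ)) x := fun x =>
    divB_smul_one_eq (torusT (F.P K) 0) _ _ (fun κ z => τ ⟨z, κ⟩) x
  rw [norm_sq_DstarL2_toL2_eq, norm_sq_DstarL2_toL2_eq]
  simp only [LinearEquiv.symm_apply_apply, hC, hD]

/-! ## §3 `hcen` (for the door's `H`) at `W ∈ RegPr` from the flat row ✓`Prop7QH1CentralRowFlat.hcen_one` -/

/-- ★★★ **THE CENTRAL (QH1) ROW DOES NOT SEE THE BACKGROUND.**  The FLAT central (QH1)♮ row for the door's `H` — px22 g6's `hcen_one` text VERBATIM as the hypothesis `hflat`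
(`W := 1`, `RegPr F n K e 1`, constants `B B′ B″ eQ`) — implies the `hcen` binder of ✓`Prop7QH1OfSectors.hQH1_of_sectors` at `H :=` the door lambda, for EVERY `W ∈ RegPr F n K e`,
`e ≤ min eQ (10⁷L³)⁻¹`, same `B B′ B″`: `Qkc W (toL2 (τ•1)) = Qkc 1 (toL2 (τ•1))` (§1), the door's `H` is background-free on central one-forms (§2), `RegPr F n K e 1` by lit ✓`regPr_one`.
[cite: Balaban1985BackgroundPropagators, (3.4) p.391, (3.8) p.392, (3.11) p.392, (3.14) p.393; Balaban1985Variational, (2) p.278, (44)-(45) p.285] -/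
theorem hcen_doorH_of_flat
    (hflat :

    ∀ (L : ℕ), 1 < L → ∃ B B' B'' eQ : ℝ, 0 ≤ B ∧ 0 ≤ B' ∧ 0 ≤ B'' ∧ 0 < eQ ∧
      ∀ (F : T3Family), F.L = L → ∀ (n K : ℕ) (hnK : n < K) (e : ℝ),
        0 < e → e ≤ eQ → RegPr F n K e (1 : GaugeField (F.P K) 0 (Matrix.specialUnitaryGroup (Fin 2) ℂ)) →
        ∀ τ : PBond (F.P K) 0 → ℂ,
          (c₀ F.L / cB F.L) * ((F.L : ℝ) ^ (K - n)) ^ 3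
              * ‖Qkc F n K hnK.le (c₀ F.L) (cB F.L) (1 : GaugeField (F.P K) 0 (Matrix.specialUnitaryGroup (Fin 2) ℂ))
                  (toL2 F K (c₀ F.L) (fun b => τ b • (1 : Matrix (Fin 2) (Fin 2) ℂ)))‖ ^ 2
            ≤ B * ‖toL2 F K (c₀ F.L) (fun b => τ b • (1 : Matrix (Fin 2) (Fin 2) ℂ))‖ ^ 2
              + B' * ((fun (F : T3Family) (n K : ℕ) (W : GaugeField (F.P K) 0 (Matrix.specialUnitaryGroup (Fin 2) ℂ))
                    (f : BondL2K ℂ 3 (periodsT3 F K) (c₀ F.L) W₂) =>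
                  c₀ F.L * ((F.L : ℝ) ^ (K - n)) ^ 2 * (∑ x : Site (F.P K) 0, ∑ μ : Fin (F.P K).d, ∑ ν : Fin (F.P K).d,
                      (if μ < ν then ∑ j : Fin 2, ∑ k : Fin 2,
                        ‖(curl (torusT (F.P K) 0) (fun κ z => unitsField (toUField W) ⟨z, κ⟩) (fun κ z => (toL2 F K (c₀ F.L)).symm f ⟨z, κ⟩) μ ν x) j k‖ ^ 2 else 0))
                    + ‖DstarL2 F n K (c₀ F.L) W f‖ ^ 2)
                  F n K (1 : GaugeField (F.P K) 0 (Matrix.specialUnitaryGroup (Fin 2) ℂ)) (toL2 F K (c₀ F.L) (fun b => τ b • (1 : Matrix (Fin 2) (Fin 2) ℂ))))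
              + B'' * e * ‖toL2 F K (c₀ F.L) (fun b => τ b • (1 : Matrix (Fin 2) (Fin 2) ℂ))‖ ^ 2) :

    ∀ (L : ℕ), 1 < L → ∃ B B' B'' eQ : ℝ, 0 ≤ B ∧ 0 ≤ B' ∧ 0 ≤ B'' ∧ 0 < eQ ∧
      ∀ (F : T3Family), F.L = L → ∀ (n K : ℕ) (hnK : n < K) (e : ℝ) (W : GaugeField (F.P K) 0 (Matrix.specialUnitaryGroup (Fin 2) ℂ)),
        0 < e → e ≤ eQ → RegPr F n K e W →
        ∀ τ : PBond (F.P K) 0 → ℂ,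
          (c₀ F.L / cB F.L) * ((F.L : ℝ) ^ (K - n)) ^ 3
              * ‖Qkc F n K hnK.le (c₀ F.L) (cB F.L) W
                  (toL2 F K (c₀ F.L) (fun b => τ b • (1 : Matrix (Fin 2) (Fin 2) ℂ)))‖ ^ 2
            ≤ B * ‖toL2 F K (c₀ F.L) (fun b => τ b • (1 : Matrix (Fin 2) (Fin 2) ℂ))‖ ^ 2
              + B' * ((fun (F : T3Family) (n K : ℕ) (W : GaugeField (F.P K) 0 (Matrix.specialUnitaryGroup (Fin 2) ℂ))
                    (f : BondL2K ℂ 3 (periodsT3 F K) (c₀ F.L) W₂) =>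
                  c₀ F.L * ((F.L : ℝ) ^ (K - n)) ^ 2 * (∑ x : Site (F.P K) 0, ∑ μ : Fin (F.P K).d, ∑ ν : Fin (F.P K).d,
                      (if μ < ν then ∑ j : Fin 2, ∑ k : Fin 2,
                        ‖(curl (torusT (F.P K) 0) (fun κ z => unitsField (toUField W) ⟨z, κ⟩) (fun κ z => (toL2 F K (c₀ F.L)).symm f ⟨z, κ⟩) μ ν x) j k‖ ^ 2 else 0))
                    + ‖DstarL2 F n K (c₀ F.L) W f‖ ^ 2)
                  F n K W (toL2 F K (c₀ F.L) (fun b => τ b • (1 : Matrix (Fin 2) (Fin 2) ℂ))))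
              + B'' * e * ‖toL2 F K (c₀ F.L) (fun b => τ b • (1 : Matrix (Fin 2) (Fin 2) ℂ))‖ ^ 2 := by
  intro L hL
  obtain ⟨B, B', B'', eQ, hB, hB', hB'', heQ, hrow⟩ := hflat L hL
  have hL0 : (0 : ℝ) < (L : ℝ) := by exact_mod_cast (lt_trans zero_lt_one hL)
  refine ⟨B, B', B'', min eQ (10 ^ 7 * (L : ℝ) ^ 3)⁻¹, hB, hB', hB'', lt_min heQ (by positivity), ?_⟩
  intro F hF n K hnK e W he heQ' hreg τ
  have he1 : e ≤ eQ := heQ'.trans (min_le_left _ _)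
  have he2 : e ≤ (10 ^ 7 * (L : ℝ) ^ 3)⁻¹ := heQ'.trans (min_le_right _ _)
  have h1 := hrow F hF n K hnK e he he1 (regPr_one he) τ
  subst hF
  have hpos : (0 : ℝ) < 10 ^ 7 * (F.L : ℝ) ^ 3 := by positivity
  have hε : 10 ^ 7 * (F.L : ℝ) ^ 3 * e ≤ 1 := by
    calc 10 ^ 7 * (F.L : ℝ) ^ 3 * e ≤ 10 ^ 7 * (F.L : ℝ) ^ 3 * (10 ^ 7 * (F.L : ℝ) ^ 3)⁻¹ := mul_le_mul_of_nonneg_left he2 hpos.le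
      _ = 1 := mul_inv_cancel₀ hpos.ne'
  beta_reduce at h1 ⊢
  rw [Qkc_toL2_smul_one_eq_one_of_regPr c₀ cB F hnK.le he hε W hreg τ, doorH_smul_one_eq_one c₀ F n K W τ]
  exact h1

end Summit.QuantumFields.YangMills.Theorems.Prop7QH1CentralOfFlat

end
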